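import Summits.SmoothPoincare4.SmoothPoincare4.Theorems.DottedCircleRasmussenDcrGapHelperFriendsCarrierVkPartAPartIPartition
import Literature.AlgebraicTopology.FundamentalGroup.PuncturedPlane

/-!
# Helper `helper_friendsCarrier_Vk_partA_partI` (V_k part A, part I: the tube framing is the Seifert
framing), piece 5: the detecting functionals on the complement of the compact part of the picture
(line `mk_friends`, crux `DcrGap`; item stmt-SmoothPoincare4-16128, route route-SmoothPoincare4-DottedCircleRasmussen)

On `O = 𝕊³ ∖ P(M_k ∩ {|w|² ≥ ε})` (`0 < ε ≤ 1/20`) we construct continuous maps to the punctured plane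
`ℂ ∖ 0` which detect the core-parallel loop of the axis tube and the fibre circles of the dotted tubes:

* the **axis functional** `f₀`: on the far piece of `O` (an open solid torus about the great circle
  `A = 𝔇_a{x₀ = x₁ = 0}` through the axis and the point at infinity, `𝔇_a` the Möbius dilation of the tree,
  `MMSWPictureOuterChart`) the direction of the last two coordinates of `𝔇_{1/a} y` — the position along `A`,
  which on the picture of a point `(z, w)` of `M_k` is the co-latitude direction of `z`
  (`axisTubeVec_coLatDir_latS`) — and `1` on the near pieces;
* the **revolution functionals** `f_j`: on the near piece about the hole `j` the direction `w̄/|w|` of the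
  planar position (the angle about the axis), and `1` elsewhere.

Continuity is by the clopen pieces of piece 4 (`partO_isClopen_far/near`).

* `FriendsCarrierVk.funcO_*` — the constructions;
* `helper_friendsCarrier_Vk_partA_partI_functionals` — the registered statement.

No definitions, no named facts, no `sorry`.

## References

* R. Kirby, *The Topology of 4-Manifolds*, LNM 1374 (1989), Ch. I §2. [Kirby1989]
* A. Hatcher, *Algebraic Topology*, CUP (2002), §2.2 (the Mayer–Vietoris bookkeeping of `S³ = ∂(S¹ × D²) ∪ …`). [HatcherAT2002]
-/

set_option linter.dupNamespace false
set_option linter.style.longLine false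

noncomputable section

open scoped Manifold ContDiff Topology ComplexConjugate
open Function Set Metric TopologicalSpace Literature.Topology.FourManifolds Literature.Topology.FourManifolds.MMSW Literature.AlgebraicTopology.Homotopy.HopfFibration
  Literature.AlgebraicTopology.FundamentalGroup.PuncturedPlane

namespace Summit.SmoothPoincare4.SmoothPoincare4.Theorems.DcrGap.MkFriends

namespace FriendsCarrierVk

variable {k : ℕ} {ε : ℝ}

/-! ## The axis functional -/

/-- **Off the circle `𝔇_a{x₂ = x₃ = 0}` the position along the axis circle is defined**: for a point of the
far piece (north pole, axis, or planar reading `|z| > 20(k+1)`) the last two coordinates of `𝔇_{1/a} y` do not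
both vanish — they vanish exactly on the horizontal circle of radius `a` at height `0`, whose planar reading is
`z = a − C_k`, `|z| < 9(k+1)`. [folklore] -/
theorem funcO_proj23_ne_zero {y : sphere (0 : EuclideanSpace ℝ (Fin 4)) 1}
    (hy : y = northPole ∨ chartC (stereoNorthCoords (y : EuclideanSpace ℝ (Fin 4))) = 0 ∨
      20 * ((k : ℝ) + 1) < ‖chartZ k (stereoNorthCoords (y : EuclideanSpace ℝ (Fin 4)))‖) :
    proj23 (dilCoe (focal k)⁻¹ (y : EuclideanSpace ℝ (Fin 4))) ≠ 0 := by
  intro h0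
  have hk : (0 : ℝ) ≤ k := Nat.cast_nonneg k
  have ha := focal_pos (k := k)
  set b : ℝ := (focal k)⁻¹ with hb
  have hb0 : 0 < b := inv_pos.2 ha
  set x : EuclideanSpace ℝ (Fin 4) := (y : EuclideanSpace ℝ (Fin 4)) with hx
  have hn : ‖x‖ = 1 := norm_eq_of_mem_sphere y
  have hD : 0 < dilDen b x := dilDen_pos_of_norm_eq_one hb0.ne' hn
  have h2 : dilCoe b x 2 = 0 := by simpa [proj23] using congrArg (fun v : EuclideanSpace ℝ (Fin 2) => v 0) h0
  have h3 : dilCoe b x 3 = 0 := by simpa [proj23] using congrArg (fun v : EuclideanSpace ℝ (Fin 2) => v 1) h0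
  rw [dilCoe_apply_two, div_eq_zero_iff] at h2
  rw [dilCoe_apply_three, div_eq_zero_iff] at h3
  have hx2 : x 2 = 0 := by
    rcases h2 with h2 | h2
    · have : 2 * b ≠ 0 := by positivity
      exact (mul_eq_zero.1 h2).resolve_left this
    · linarith
  have hx3 : b ^ 2 * (1 + x 3) = 1 - x 3 := by
    rcases h3 with h3 | h3
    · linarith
    · linarith
  have hsq : x 0 ^ 2 + x 1 ^ 2 + x 2 ^ 2 + x 3 ^ 2 = 1 := by rw [← norm_sq_fin_four, hn, one_pow]
  rcases hy with hN | hC | hfar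
  · -- the north pole: `x₃ = 1` forces `b = 0`
    have : x 3 = 1 := by rw [hx, hN, coe_northPole]; simp
    rw [this] at hx3
    nlinarith
  · have hN : y ≠ northPole := by
      intro hN
      have : x 3 = 1 := by rw [hx, hN, coe_northPole]; simp
      rw [this] at hx3; nlinarith
    have h31 : x 3 ≠ 1 := apply_three_ne_one_of_ne_northPole hN
    have h13 : (1 - x 3)⁻¹ ≠ 0 := inv_ne_zero (sub_ne_zero.2 h31.symm)
    -- the axis: `x₀ = x₁ = 0` forces `x₃ = -1`, incompatible with `b²(1 + x₃) = 1 − x₃`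
    have h00 : (1 - x 3)⁻¹ * x 0 = 0 := by
      simpa only [chartC_re, Complex.zero_re, stereoNorthCoords] using congrArg Complex.re hC
    have h01 : (1 - x 3)⁻¹ * x 1 = 0 := by
      simpa only [chartC_im, Complex.zero_im, stereoNorthCoords] using congrArg Complex.im hC
    have hx0 : x 0 = 0 := (mul_eq_zero.1 h00).resolve_left h13
    have hx1 : x 1 = 0 := (mul_eq_zero.1 h01).resolve_left h13
    rw [hx0, hx1, hx2] at hsq
    have h' : (x 3 - 1) * (x 3 + 1) = 0 := by nlinarith [hsq]
    rcases mul_eq_zero.1 h' with h | h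
    · exact h31 (by linarith)
    · have : x 3 = -1 := by linarith
      rw [this] at hx3; norm_num at hx3
  · have hN : y ≠ northPole := by
      intro hN
      have : x 3 = 1 := by rw [hx, hN, coe_northPole]; simp
      rw [this] at hx3; nlinarith
    have h31 : x 3 ≠ 1 := apply_three_ne_one_of_ne_northPole hN
    have h13 : 0 < 1 - x 3 := by
      have := abs_apply_le_norm_four x 3
      rw [hn] at this
      rcases (abs_le.1 this).2.lt_or_eq with h | h
      · linarith
      · exact absurd h h31
    -- the far case: the reading is `z = a − C_k`
    have hC2 : ‖chartC (stereoNorthCoords x)‖ ^ 2 = focal k ^ 2 := by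
      rw [Complex.sq_norm, Complex.normSq_apply]
      simp only [chartC_re, chartC_im, stereoNorthCoords]
      have h01 : x 0 ^ 2 + x 1 ^ 2 = (1 - x 3) * (1 + x 3) := by rw [hx2] at hsq; nlinarith
      have hb2 : b ^ 2 * focal k ^ 2 = 1 := by rw [hb, inv_pow, inv_mul_cancel₀ (pow_ne_zero 2 ha.ne')]
      have hfx : focal k ^ 2 * (1 - x 3) = 1 + x 3 := by
        calc focal k ^ 2 * (1 - x 3) = focal k ^ 2 * (b ^ 2 * (1 + x 3)) := by rw [hx3]
          _ = (b ^ 2 * focal k ^ 2) * (1 + x 3) := by ring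
          _ = 1 + x 3 := by rw [hb2, one_mul]
      have e1 : (1 - x 3)⁻¹ * x 0 * ((1 - x 3)⁻¹ * x 0) + (1 - x 3)⁻¹ * x 1 * ((1 - x 3)⁻¹ * x 1) =
          (1 - x 3)⁻¹ * ((1 - x 3)⁻¹ * (x 0 ^ 2 + x 1 ^ 2)) := by ring
      rw [e1, h01, ← hfx]
      field_simp
    have hCn : ‖chartC (stereoNorthCoords x)‖ = focal k := by
      have h0 : 0 ≤ ‖chartC (stereoNorthCoords x)‖ := norm_nonneg _
      nlinarith [hC2, ha]
    have hZ : chartZ k (stereoNorthCoords x) = ((focal k - drawRadius k : ℝ) : ℂ) := by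
      apply Complex.ext
      · rw [chartZ_re, hCn, Complex.ofReal_re]
      · rw [chartZ_im, Complex.ofReal_im]
        simp [stereoNorthCoords, hx2]
    rw [hZ, Complex.norm_real, Real.norm_eq_abs, abs_sub_comm, abs_of_pos (by linarith [focal_lt_drawRadius (k := k)])] at hfar
    have := lt_focal (k := k)
    unfold drawRadius at hfar
    linarith

/-- The value of the axis position at the picture of a far point `(z, w)` of `M_k` off the cores: the
co-latitude direction of `z`. [folklore] -/
theorem funcO_axis_value {x : EuclideanSpace ℝ (Fin 4)} (hx : x ∈ modelBoundary k) (hw : wC x ≠ 0)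
    (hfar : 20 * ((k : ℝ) + 1) < ‖zC x‖) :
    toC (‖proj23 (dilCoe (focal k)⁻¹ ((stereoNorthInv (draw k x) : sphere (0 : EuclideanSpace ℝ (Fin 4)) 1) : EuclideanSpace ℝ (Fin 4)))‖⁻¹ •
        proj23 (dilCoe (focal k)⁻¹ ((stereoNorthInv (draw k x) : sphere (0 : EuclideanSpace ℝ (Fin 4)) 1) : EuclideanSpace ℝ (Fin 4)))) =
      toC (coLatDir k (zC x)) := by
  set z := zC x with hz
  set u : EuclideanSpace ℝ (Fin 2) := toE2 (conj (unitDir 0 (wC x))) with hu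
  have hun : ‖u‖ = 1 := by rw [hu, norm_toE2, Complex.norm_conj, norm_unitDir hw]
  have hdraw : draw k x = (((z.re + drawRadius k) * u 0, (z.re + drawRadius k) * u 1), z.im) := by
    rw [draw_eq_cpt, cpt]
    simp [hu, toE2, hz]
  have hco : coLat k z ≠ 0 := by
    have hM : (zC x, wC x) ∈ Mset k := (mem_Mset_iff x).2 hx
    exact coLat_ne_zero_of_lt_norm (by linarith) (norm_fst_lt_drawRadius_of_mem hM)
  have hlat1 : latS k z < 1 := latS_lt_one_of_coLat_ne_zero hco
  have hlat0 : 0 ≤ latS k z := (latS_pos_of_norm_lt (norm_fst_lt_drawRadius_of_mem ((mem_Mset_iff x).2 hx))).le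
  have hv : dilCoe (focal k)⁻¹ ((stereoNorthInv (draw k x) : sphere (0 : EuclideanSpace ℝ (Fin 4)) 1) : EuclideanSpace ℝ (Fin 4)) =
      axisTubeVec (coLatDir k z) (latS k z • u) := by
    rw [coe_stereoNorthInv, dilCoe_stereoNorthInvCoe, axisTubeVec_coLatDir_latS z hun, hdraw]
  have hζ : ‖latS k z • u‖ = latS k z := by rw [norm_smul, Real.norm_of_nonneg hlat0, hun, mul_one]
  have hs : 0 < Real.sqrt (1 - ‖latS k z • u‖ ^ 2) := Real.sqrt_pos.2 (by rw [hζ]; nlinarith)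
  have he : ‖coLatDir k z‖ = 1 := norm_coLatDir hco
  rw [hv, proj23_axisTubeVec, norm_smul, Real.norm_of_nonneg hs.le, he, mul_one, smul_smul, inv_mul_cancel₀ hs.ne', one_smul]

/-! ## The revolution functionals -/

/-- The direction of the planar position of the picture of a point `(z, w)` of `M_k` off the cores is `w̄/|w|`.
[folklore] -/
theorem funcO_dirC_draw {x : EuclideanSpace ℝ (Fin 4)} (hx : x ∈ modelBoundary k) (hw : wC x ≠ 0) :
    dirC (draw k x) = conj (unitDir 0 (wC x)) := by
  have hre := re_zC_add_drawRadius_pos hx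
  have hu : ‖conj (unitDir 0 (wC x))‖ = 1 := by rw [Complex.norm_conj, norm_unitDir hw]
  rw [dirC, draw_eq_cpt, chartC_cpt, ← zero_add ((((zC x).re + drawRadius k : ℝ) : ℂ) * _), unitDir_ray hu hre]

/-- The picture of a point of `M_k` off the cores, as a point of `O`, is off the north pole and off the axis, and
reads the planar point `z`. [folklore] -/
theorem funcO_pic_readings {x : EuclideanSpace ℝ (Fin 4)} (hx : x ∈ modelBoundary k) (hw : wC x ≠ 0) :
    stereoNorthInv (draw k x) ≠ northPole ∧
      chartC (stereoNorthCoords ((stereoNorthInv (draw k x) : sphere (0 : EuclideanSpace ℝ (Fin 4)) 1) : EuclideanSpace ℝ (Fin 4))) ≠ 0 ∧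
      chartZ k (stereoNorthCoords ((stereoNorthInv (draw k x) : sphere (0 : EuclideanSpace ℝ (Fin 4)) 1) : EuclideanSpace ℝ (Fin 4))) = zC x := by
  have hreg := draw_mem_pictureRegion hx hw
  refine ⟨stereoNorthInv_ne_northPole _, ?_, ?_⟩ <;> rw [pic_coords_P]
  · exact hreg.1
  · exact chartZ_draw hx hw

/-- **The revolution functional about the hole `j`** (`0 < ε ≤ 1/20`): a continuous map `O → ℂ ∖ 0` equal to
`w̄/|w|` at the pictures of points `(z, w)` of `M_k` with `|z − c_j| < 27/20` and to `1` at those with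
`|z − c_j| ≥ 27/20`. [folklore] -/
theorem funcO_exists_revolution (hε : 0 < ε) (hε' : ε ≤ 1 / 20) {O : Set (sphere (0 : EuclideanSpace ℝ (Fin 4)) 1)}
    (hO : O = ((fun x : EuclideanSpace ℝ (Fin 4) => stereoNorthInv (draw k x)) '' {x | x ∈ modelBoundary k ∧ ε ≤ ‖wC x‖ ^ 2})ᶜ) (j : Fin k) :
    ∃ f : C(↥O, CStar), ∀ (x : EuclideanSpace ℝ (Fin 4)) (hxO : stereoNorthInv (draw k x) ∈ O), x ∈ modelBoundary k → wC x ≠ 0 →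
      (‖zC x - holeCentre k j‖ < 27 / 20 → ((f ⟨stereoNorthInv (draw k x), hxO⟩ : CStar) : ℂ) = conj (unitDir 0 (wC x))) ∧
      (27 / 20 ≤ ‖zC x - holeCentre k j‖ → ((f ⟨stereoNorthInv (draw k x), hxO⟩ : CStar) : ℂ) = 1) := by
  classical
  set S : Set ↥O := {y : ↥O | (y : sphere (0 : EuclideanSpace ℝ (Fin 4)) 1) ≠ northPole ∧
      chartC (stereoNorthCoords ((y : sphere (0 : EuclideanSpace ℝ (Fin 4)) 1) : EuclideanSpace ℝ (Fin 4))) ≠ 0 ∧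
      ‖chartZ k (stereoNorthCoords ((y : sphere (0 : EuclideanSpace ℝ (Fin 4)) 1) : EuclideanSpace ℝ (Fin 4))) - holeCentre k j‖ < 27 / 20} with hS
  have hSc : IsClopen S := partO_isClopen_near hε hε' hO j
  set g : ↥O → ℂ := fun y => dirC (stereoNorthCoords ((y : sphere (0 : EuclideanSpace ℝ (Fin 4)) 1) : EuclideanSpace ℝ (Fin 4))) with hg
  have hgc : ContinuousOn g S := by
    intro y hy
    have h1 : ContinuousAt (fun y : sphere (0 : EuclideanSpace ℝ (Fin 4)) 1 => stereoNorthCoords (y : EuclideanSpace ℝ (Fin 4))) (y : sphere (0 : EuclideanSpace ℝ (Fin 4)) 1) :=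
      (pic_continuousOn_coords _ hy.1).continuousAt ((isOpen_ne_fun continuous_id continuous_const).mem_nhds hy.1)
    exact (ContinuousAt.comp (x := y) (ContinuousAt.comp (x := (y : sphere (0 : EuclideanSpace ℝ (Fin 4)) 1))
      (contDiffAt_dirC hy.2.1).continuousAt h1) continuous_subtype_val.continuousAt).continuousWithinAt
  set F : ↥O → ℂ := S.piecewise g (fun _ => 1) with hF
  have hFc : Continuous F := continuous_piecewise (by rw [hSc.frontier_eq]; simp) (by rw [hSc.isClosed.closure_eq]; exact hgc)
    continuousOn_const
  have hF0 : ∀ y, F y ≠ 0 := by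
    intro y
    by_cases hy : y ∈ S
    · rw [hF, piecewise_eq_of_mem _ _ _ hy, hg, ← norm_ne_zero_iff, norm_dirC hy.2.1]; exact one_ne_zero
    · rw [hF, piecewise_eq_of_notMem _ _ _ hy]; exact one_ne_zero
  refine ⟨⟨fun y => ⟨F y, hF0 y⟩, hFc.subtype_mk _⟩, fun x hxO hx hw => ?_⟩
  obtain ⟨hN, hC, hZ⟩ := funcO_pic_readings hx hw
  constructor
  · intro hnear
    have hy : (⟨stereoNorthInv (draw k x), hxO⟩ : ↥O) ∈ S := ⟨hN, hC, by rw [hZ]; exact hnear⟩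
    show F _ = _
    rw [hF, piecewise_eq_of_mem _ _ _ hy, hg]
    show dirC (stereoNorthCoords ((stereoNorthInv (draw k x) : sphere (0 : EuclideanSpace ℝ (Fin 4)) 1) : EuclideanSpace ℝ (Fin 4))) = _
    rw [pic_coords_P, funcO_dirC_draw hx hw]
  · intro hfar
    have hy : (⟨stereoNorthInv (draw k x), hxO⟩ : ↥O) ∉ S := fun h => by
      have := h.2.2; rw [hZ] at this; linarith
    show F _ = _
    rw [hF, piecewise_eq_of_notMem _ _ _ hy]

/-- **The axis functional** (`0 < ε ≤ 1/20`): a continuous map `O → ℂ ∖ 0` equal to the co-latitude direction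
of `z` at the pictures of far points `(z, w)` of `M_k` and to `1` at those near a hole. [folklore] -/
theorem funcO_exists_axis (hε : 0 < ε) (hε' : ε ≤ 1 / 20) {O : Set (sphere (0 : EuclideanSpace ℝ (Fin 4)) 1)}
    (hO : O = ((fun x : EuclideanSpace ℝ (Fin 4) => stereoNorthInv (draw k x)) '' {x | x ∈ modelBoundary k ∧ ε ≤ ‖wC x‖ ^ 2})ᶜ) :
    ∃ f : C(↥O, CStar), ∀ (x : EuclideanSpace ℝ (Fin 4)) (hxO : stereoNorthInv (draw k x) ∈ O), x ∈ modelBoundary k → wC x ≠ 0 →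
      (20 * ((k : ℝ) + 1) < ‖zC x‖ → ((f ⟨stereoNorthInv (draw k x), hxO⟩ : CStar) : ℂ) = toC (coLatDir k (zC x))) ∧
      ((∃ j : Fin k, ‖zC x - holeCentre k j‖ < 27 / 20) → ((f ⟨stereoNorthInv (draw k x), hxO⟩ : CStar) : ℂ) = 1) := by
  classical
  set S : Set ↥O := {y : ↥O | (y : sphere (0 : EuclideanSpace ℝ (Fin 4)) 1) = northPole ∨
      chartC (stereoNorthCoords ((y : sphere (0 : EuclideanSpace ℝ (Fin 4)) 1) : EuclideanSpace ℝ (Fin 4))) = 0 ∨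
      20 * ((k : ℝ) + 1) < ‖chartZ k (stereoNorthCoords ((y : sphere (0 : EuclideanSpace ℝ (Fin 4)) 1) : EuclideanSpace ℝ (Fin 4)))‖} with hS
  have hSc : IsClopen S := partO_isClopen_far hε hε' hO
  have ha := focal_pos (k := k)
  set p : ↥O → EuclideanSpace ℝ (Fin 2) := fun y => proj23 (dilCoe (focal k)⁻¹ ((y : sphere (0 : EuclideanSpace ℝ (Fin 4)) 1) : EuclideanSpace ℝ (Fin 4))) with hp
  have hpc : Continuous p := by
    have h2 : Continuous fun y : ↥O => dilCoe (focal k)⁻¹ ((y : sphere (0 : EuclideanSpace ℝ (Fin 4)) 1) : EuclideanSpace ℝ (Fin 4)) := by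
      refine continuous_iff_continuousAt.2 fun y => ?_
      have hD := (dilDen_pos_of_norm_eq_one (inv_ne_zero ha.ne') (norm_eq_of_mem_sphere (y : sphere (0 : EuclideanSpace ℝ (Fin 4)) 1))).ne'
      exact ContinuousAt.comp (g := dilCoe (focal k)⁻¹)
        (f := fun y : ↥O => ((y : sphere (0 : EuclideanSpace ℝ (Fin 4)) 1) : EuclideanSpace ℝ (Fin 4))) (x := y)
        (contDiffAt_dilCoe (n := ∞) hD).continuousAt (continuous_subtype_val.comp continuous_subtype_val).continuousAt
    exact contDiff_proj23.continuous.comp h2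
  set g : ↥O → ℂ := fun y => toC (‖p y‖⁻¹ • p y) with hg
  have hgc : ContinuousOn g S := by
    intro y hy
    have h0 : p y ≠ 0 := funcO_proj23_ne_zero hy
    have h1 : ContinuousAt (fun y => ‖p y‖⁻¹ • p y) y :=
      ((hpc.norm.continuousAt).inv₀ (norm_ne_zero_iff.2 h0)).smul hpc.continuousAt
    exact (contDiff_toC.continuous.continuousAt.comp h1).continuousWithinAt
  set F : ↥O → ℂ := S.piecewise g (fun _ => 1) with hF
  have hFc : Continuous F := continuous_piecewise (by rw [hSc.frontier_eq]; simp) (by rw [hSc.isClosed.closure_eq]; exact hgc)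
    continuousOn_const
  have hF0 : ∀ y, F y ≠ 0 := by
    intro y
    by_cases hy : y ∈ S
    · have h0 : p y ≠ 0 := funcO_proj23_ne_zero hy
      rw [hF, piecewise_eq_of_mem _ _ _ hy, hg, ← norm_ne_zero_iff]
      show ‖toC (‖p y‖⁻¹ • p y)‖ ≠ 0
      rw [norm_toC, norm_smul, norm_inv, norm_norm, inv_mul_cancel₀ (norm_ne_zero_iff.2 h0)]; exact one_ne_zero
    · rw [hF, piecewise_eq_of_notMem _ _ _ hy]; exact one_ne_zero
  refine ⟨⟨fun y => ⟨F y, hF0 y⟩, hFc.subtype_mk _⟩, fun x hxO hx hw => ?_⟩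
  obtain ⟨hN, hC, hZ⟩ := funcO_pic_readings hx hw
  constructor
  · intro hfar
    have hy : (⟨stereoNorthInv (draw k x), hxO⟩ : ↥O) ∈ S := Or.inr (Or.inr (by rw [hZ]; exact hfar))
    show F _ = _
    rw [hF, piecewise_eq_of_mem _ _ _ hy, hg]
    exact funcO_axis_value hx hw hfar
  · rintro ⟨j, hj⟩
    have hy : (⟨stereoNorthInv (draw k x), hxO⟩ : ↥O) ∉ S := by
      rintro (h | h | h)
      · exact hN h
      · exact hC h
      · rw [hZ] at h; linarith [(pic_near_bounds hj).1]
    show F _ = _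
    rw [hF, piecewise_eq_of_notMem _ _ _ hy]

end FriendsCarrierVk

open FriendsCarrierVk in
/-- **Piece 5 of part I of V_k part A: the detecting functionals on `O = 𝕊³ ∖ P(M_k ∩ {|w|² ≥ ε})`**
(`0 < ε ≤ 1/20`): the axis functional (co-latitude direction of `z` at pictures of far points, `1` at pictures of
near points) and, for every hole `j`, the revolution functional (`w̄/|w|` at pictures of points near `c_j`, `1`
at the other pictures), as continuous maps to `ℂ ∖ 0`. [cite: HatcherAT2002, §2.2] -/
theorem helper_friendsCarrier_Vk_partA_partI_functionals : ∀ (k : ℕ) (ε : ℝ), 0 < ε → ε ≤ 1 / 20 → ∀ (O : Set (sphere (0 : EuclideanSpace ℝ (Fin 4)) 1)), O = ((fun x : EuclideanSpace ℝ (Fin 4) => stereoNorthInv (draw k x)) '' {x | x ∈ modelBoundary k ∧ ε ≤ ‖wC x‖ ^ 2})ᶜ → (∃ f : C(↥O, CStar), ∀ (x : EuclideanSpace ℝ (Fin 4)) (hxO : stereoNorthInv (draw k x) ∈ O), x ∈ modelBoundary k → wC x ≠ 0 → (20 * ((k : ℝ) + 1) < ‖zC x‖ → ((f ⟨stereoNorthInv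 (draw k x), hxO⟩ : CStar) : ℂ) = toC (coLatDir k (zC x))) ∧ ((∃ j : Fin k, ‖zC x - holeCentre k j‖ < 27 / 20) → ((f ⟨stereoNorthInv (draw k x), hxO⟩ : CStar) : ℂ) = 1)) ∧ ∀ j : Fin k, ∃ f : C(↥O, CStar), ∀ (x : EuclideanSpace ℝ (Fin 4)) (hxO : stereoNorthInv (draw k x) ∈ O), x ∈ modelBoundary k → wC x ≠ 0 → (‖zC x - holeCentre k j‖ < 27 / 20 → ((f ⟨stereoNorthInv (draw k x), hxO⟩ : CStar) : ℂ) = conj (unitDir 0 (wC x))) ∧ (27 / 20 ≤ ‖zC x - holeCentre k j‖ → ((f ⟨stereoNorthInv (draw k x), hxO⟩ : CStar) : ℂ) = 1) :=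
  fun _ _ hε hε' _ hO => ⟨funcO_exists_axis hε hε' hO, fun j => funcO_exists_revolution hε hε' hO j⟩

end Summit.SmoothPoincare4.SmoothPoincare4.Theorems.DcrGap.MkFriends
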